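import Mathlib
import Literature.NumberTheory.Transcendental.KZCalculusProofs
import Literature.NumberTheory.Transcendental.KZCubicalCalculus
import Literature.NumberTheory.Transcendental.KZLogCalculusProofs
import Literature.NumberTheory.Transcendental.KZProductIdeal

/-!
# OffTetraSectorKernel (stmt-KontsevichZagierPeriods-10557), line odd-hyperbolic-ladder: stub stub_dimensionDrop

THE INDUCTION STEP OF THE MOSER TOWER, TYPED. A representation `G` on the unit cube `[0,1]^{d+1}`
whose integrand omits the coordinate `i` — it is the integrand of `G'` (on `[0,1]^d`) read through
`Fin.removeNth i` — is KZ-equivalent to `G'`.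

Proof. Let `e : Fin (d+1) ≃ Fin (d+1)` be the coordinate permutation sending `i` to the last index
and `i.succAbove k` to `k.castSucc` (`(finSuccEquiv' i).trans (finSuccEquiv' (Fin.last d)).symm`).
Then `i.removeNth (w ∘ e) = Fin.init w`, so the reindexed representation `G.reindex e`
(rule (2), a permutation matrix, `KZ.of_sub_of_reindex_mem_relations`) has domain the cube
`[0,1]^{d+1} = [0,1]^d × [0,1]` and integrand `w ↦ G'.integrand (Fin.init w)`: it agrees on its
domain with the slab `G'.slab 0` (rule (3), Newton–Leibniz, `KZ.IntegralRep.equivalent_slab`), and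
the congruence `KZ.of_sub_of_mem_relations_of_eqOn` closes the chain
`[G] ≡ [G.reindex e] ≡ [G'.slab 0] ≡ [G']`.
-/

noncomputable section

open Set MeasureTheory
open Literature.NumberTheory.Transcendental

namespace Summit.KontsevichZagierPeriods.HyperbolicBloch.OffTetraSectorKernel

/-- The coordinate permutation `(finSuccEquiv' i).trans (finSuccEquiv' (Fin.last d)).symm` sends
`i.succAbove k` to `k.castSucc`. [folklore] -/
theorem ddrop_perm_apply_succAbove (d : ℕ) (i : Fin (d + 1)) (k : Fin d) :
    ((finSuccEquiv' i).trans (finSuccEquiv' (Fin.last d)).symm) (i.succAbove k) = k.castSucc := by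
  simp

/-- Reading a point through the coordinate permutation and then deleting the coordinate `i` is
taking its initial segment: `i.removeNth (w ∘ e) = Fin.init w`. [folklore] -/
theorem ddrop_removeNth_comp_perm (d : ℕ) (i : Fin (d + 1)) (w : Fin (d + 1) → ℝ) :
    i.removeNth (fun j => w (((finSuccEquiv' i).trans (finSuccEquiv' (Fin.last d)).symm) j)) =
      Fin.init w := by
  funext k
  simp only [Fin.removeNth, Fin.init]
  rw [ddrop_perm_apply_succAbove]

/-- A point read through a coordinate permutation lies in the unit cube iff the point does.
[folklore] -/
theorem ddrop_comp_perm_mem_cube_iff (d : ℕ) (e : Fin (d + 1) ≃ Fin (d + 1))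
    (w : Fin (d + 1) → ℝ) : (fun j => w (e j)) ∈ KZ.cube (d + 1) ↔ w ∈ KZ.cube (d + 1) := by
  simp only [KZ.mem_cube]
  constructor
  · intro h j
    simpa using h (e.symm j)
  · intro h j
    exact h (e j)

/-- STUB `stub_dimensionDrop` (THE INDUCTION STEP, TYPED): a representation on `[0,1]^{d+1}` whose
integrand omits the coordinate `i` (it is `G'` read through `Fin.removeNth i`) is KZ-equivalent to
`G'` on `[0,1]^d` (one coordinate permutation, rule (2) with `|det| = 1`; one slab, rule (3)).
[cite: KontsevichZagier2001, §1.2 rules (2), (3)] -/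
theorem stub_dimensionDrop (d : ℕ) (i : Fin (d + 1)) (G : KZ.IntegralRep (d + 1)) (G' : KZ.IntegralRep d)
    (hG : G.domain = KZ.cube (d + 1)) (hG' : G'.domain = KZ.cube d)
    (hGG' : ∀ x ∈ G.domain, G.integrand x = G'.integrand (i.removeNth x)) : KZ.Equivalent G G' := by
  -- the coordinate permutation sending `i` to the last index
  set e : Fin (d + 1) ≃ Fin (d + 1) := (finSuccEquiv' i).trans (finSuccEquiv' (Fin.last d)).symm
    with he
  -- rule (2): reindexing is a change of variables with `|det| = 1`
  have e₁ : KZ.of G - KZ.of (G.reindex e) ∈ KZ.relations := KZ.of_sub_of_reindex_mem_relations G e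
  -- the reindexed representation agrees with the slab of `G'` at level `0`
  have e₂ : KZ.of (G.reindex e) - KZ.of (G'.slab 0) ∈ KZ.relations := by
    refine KZ.of_sub_of_mem_relations_of_eqOn ?_ ?_
    · -- domains: both are the cube `[0,1]^{d+1}`
      rw [KZ.IntegralRep.domain_slab, KZ.IntegralRep.reindex_domain, hG]
      ext w
      simp only [KZ.IntegralRep.slabDomain, hG', mem_setOf_eq, Nat.cast_zero, zero_add]
      rw [ddrop_comp_perm_mem_cube_iff, KZ.cube_succ_eq]
      simp only [mem_setOf_eq]
    · -- integrands: `G.integrand (w ∘ e) = G'.integrand (i.removeNth (w ∘ e)) = G'.integrand (init w)`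
      intro w hw
      rw [KZ.IntegralRep.reindex_domain, mem_setOf_eq] at hw
      rw [KZ.IntegralRep.reindex_integrand, KZ.IntegralRep.integrand_slab]
      dsimp only
      rw [hGG' _ hw, he, ddrop_removeNth_comp_perm]
  -- rule (3): the slab over `G'` at level `0`
  have e₃ : KZ.of G' - KZ.of (G'.slab 0) ∈ KZ.relations := G'.equivalent_slab 0
  show KZ.of G - KZ.of G' ∈ KZ.relations
  have : KZ.of G - KZ.of G' =
      (KZ.of G - KZ.of (G.reindex e)) + (KZ.of (G.reindex e) - KZ.of (G'.slab 0)) -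
        (KZ.of G' - KZ.of (G'.slab 0)) := by abel
  rw [this]
  exact KZ.relations.sub_mem (KZ.relations.add_mem e₁ e₂) e₃

end Summit.KontsevichZagierPeriods.HyperbolicBloch.OffTetraSectorKernel
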